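import Mathlib
import Summits.Ventures.HodgeRepro2.HolomorphicFiniteDimensional
import Summits.Ventures.HodgeRepro2.MultiplicityOnePeriod

/-!
# HodgePeriodParseval — Parseval for the Hodge period pairing: the self-period of a holomorphic
weight-`3` form is the sum of the squared periods against an orthonormal basis of `S_3(Γ)`

Blind cell `pub-hodge-repro2`, seat p2 (Tier 5 kernel support).

For an orthonormal basis `b` of the holomorphic part of the Petersson space (e.g. the Hecke
eigenbasis of `HeckeSpectralReal.lean`) with holomorphic representatives `g_a = holRep (b a)`, and
a holomorphic weight-`3` form `f`:

* **`setIntegral_hodgeWedge_self_eq_sum_sq_periods`**: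
  `∫_D ω_f ∧ conj ω_f = (1/4) Σ_a |∫_D ω_f ∧ conj ω_{g_a}|²` — Parseval's identity transported
  through the bridge `∫_D ω_f ∧ conj ω_g = 4 ⟨g, f⟩_Pet`;
* `setIntegral_hodgeWedge_self_eq_norm_sq`: `∫_D ω_f ∧ conj ω_f = 4 ‖[f]‖²`.
-/

namespace Summit.Ventures.HodgeRepro2.ShimuraData

open MeasureTheory

variable {K : Type*} [Field K] [NumberField K] [NumberField.IsCMField K] {τ₁ : K →+* ℂ}
  {H : Matrix (Fin 3) (Fin 3) K} {Q : Matrix (Fin 3) (Fin 3) ℂ} (hQ : IsFrame K τ₁ H Q)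
  (S : Subgroup (GL (Fin 3) K)) (hS : (S : Set (GL (Fin 3) K)) ⊆ unitaryGroup K H)
  [CompactSpace (ballQuotient hQ S hS)] {D : Set ball₂}
  (hD : IsBallFundamentalDomain hQ S hS D) (hDm : MeasurableSet D)

include hDm in
/-- `∫_D ω_f ∧ conj ω_f = 4 ‖[f]‖²`. -/
theorem setIntegral_hodgeWedge_self_eq_norm_sq (f : PeterssonForms hQ S hS 3 hD) :
    ∫ x in Subtype.val '' D, hodgeWedge (PeterssonForms.toForm hQ S hS 3 hD f)
        (PeterssonForms.toForm hQ S hS 3 hD f) x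
      = 4 * ((‖(SeparationQuotient.mk f : PeterssonSpace hQ S hS 3 hD)‖ : ℝ) : ℂ) ^ 2 := by
  rw [setIntegral_hodgeWedge_eq_inner_mk hQ S hS hD hDm f f, inner_self_eq_norm_sq_to_K]
  rfl

include hDm in
/-- **Parseval for Hodge periods.** For an orthonormal basis `b` of the holomorphic part of the
Petersson space, with holomorphic representatives `holRep (b a)`, and a holomorphic form `f`:
`∫_D ω_f ∧ conj ω_f = (1/4) Σ_a ‖∫_D ω_f ∧ conj ω_{holRep (b a)}‖²`. -/
theorem setIntegral_hodgeWedge_self_eq_sum_sq_periods {ι : Type*} [Fintype ι]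
    (b : OrthonormalBasis ι ℂ (holomorphicSpace hQ S hS 3 hD))
    {f : PeterssonForms hQ S hS 3 hD} (hf : f ∈ holomorphicForms hQ S hS 3 hD) :
    ∫ x in Subtype.val '' D, hodgeWedge (PeterssonForms.toForm hQ S hS 3 hD f)
        (PeterssonForms.toForm hQ S hS 3 hD f) x
      = (((1 / 4 : ℝ) * ∑ a, ‖∫ x in Subtype.val '' D,
          hodgeWedge (PeterssonForms.toForm hQ S hS 3 hD f)
            (PeterssonForms.toForm hQ S hS 3 hD (holRep hQ S hS 3 hD (b a))) x‖ ^ 2 : ℝ) : ℂ) := by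
  set v : holomorphicSpace hQ S hS 3 hD :=
    ⟨SeparationQuotient.mk f, mk_mem_holomorphicSpace hQ S hS 3 hD hf⟩ with hvdef
  -- each period is `4 ⟪b a, v⟫`
  have hP : ∀ a, ∫ x in Subtype.val '' D, hodgeWedge (PeterssonForms.toForm hQ S hS 3 hD f)
      (PeterssonForms.toForm hQ S hS 3 hD (holRep hQ S hS 3 hD (b a))) x
      = 4 * inner ℂ (b a) v := by
    intro a
    rw [setIntegral_hodgeWedge_eq_inner_mk hQ S hS hD hDm f, mk_holRep hQ S hS 3 hD (b a),
      Submodule.coe_inner]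
  have hnorm : ‖(SeparationQuotient.mk f : PeterssonSpace hQ S hS 3 hD)‖ = ‖v‖ := rfl
  have hpars : ∑ a, ‖inner ℂ (b a) v‖ ^ 2 = ‖v‖ ^ 2 := b.sum_sq_norm_inner_right v
  rw [setIntegral_hodgeWedge_self_eq_norm_sq hQ S hS hD hDm f, hnorm]
  simp only [hP, norm_mul, mul_pow]
  rw [← Finset.mul_sum, hpars]
  have h4 : ‖(4 : ℂ)‖ = 4 := by norm_num
  rw [h4]
  push_cast
  ring

end Summit.Ventures.HodgeRepro2.ShimuraData
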